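import Summits.Ventures.YMGap.Thresholds.LatticeBakryEmeryL2
import Summits.Ventures.YMGap.Thresholds.LatticeBakryEmeryDuality
import HarnessLib

/-!
# Venture YMGap — multi-link Bakry–Émery calculus, Part G2:
# the projection argument, THM(IV)₀, and the Poincaré inequality from THM(IV)

HONEST FRAMING: venture file (cell `pub-ymgap`, track (a), seat p2); the finite-dimensional
substitute for elliptic regularity in the kernel proof of the multi-link Bakry–Émery Poincaré
inequality on `SU(N)^E`, copied from the one-link tree file `SUNBakryEmeryPoincare.lean` Part G
("Orthogonality to `(Δ - W)𝒫`", "THM(IV)₀", "From THM(IV) to the Poincaré inequality") with `SU(N)`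
replaced by `SU(N)^E` and the one-link potential by a general polynomial potential `S ∈ 𝒫_d` with
Hessian hypothesis `HessBound S Λ`:

* `exists_proj_seq`: if `w ⟂ (Δ - W)p` for all polynomials `p` then the projections `p_n` of `w` onto
  `V_n` converge to `w`, are bounded, and satisfy `∫ Γ(p_n,p_n) = -∫ w W p_n`;
* `ae_eq_const_of_orthogonal_Lap` (THM(IV)₀): `w ⟂ Δ𝒫 ⇒ w` is a.e. constant;
* `poincare_of_thm4`: THM(IV)_S ⇒ `K ∫ e^S (u - m)² ≤ ∫ e^S Γ(u,u)`, `K = N/2 - Λ`;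
* `poincare_haar`: `(N/2) Var_{σ^{⊗E}}(u) ≤ ∫ Γ(u,u) dσ^{⊗E}`.

## References

* Tree file `SUNBakryEmeryPoincare.lean`, Part G.
-/

noncomputable section

open scoped Matrix ComplexConjugate BigOperators Matrix.Norms.Frobenius ContDiff Topology InnerProductSpace
open Matrix Complex Finset MeasureTheory Filter
open Literature.MathematicalPhysics.QuantumFieldTheory

namespace Summit.Ventures.YMGap

namespace LatticeBakryEmery

universe u

variable {ι : Type u} [Fintype ι] [DecidableEq ι] {N : ℕ}

/-! ### Orthogonality to `(Δ - W)𝒫` : the projection argument -/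

/-- **The projection argument**: if `w ∈ L²(σ^{⊗E})` is orthogonal to `(Δ - W)p` for every polynomial
`p` (`W = schW S`, `S ∈ 𝒫_d`), then the projections `p_n` of `w` onto `V_n` satisfy `p_n → w` in
`L²`, `‖p_n‖ ≤ ‖w‖`, and `∫ Γ(p_n,p_n) dσ^{⊗E} = -∫ w W p_n dσ^{⊗E}`. -/
theorem exists_proj_seq (hN : N ≠ 0) {dS : ℕ} {S : Cfg ι N → ℝ} (hS : S ∈ polySpace ι N dS)
    (w : Lp ℝ 2 (haarPi ι N))
    (hw : ∀ n, ∀ p ∈ polySpace ι N n,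
      ∫ g : PSU ι N, w g * (Lap p (emb g) - schW S (emb g) * p (emb g)) ∂(haarPi ι N) = 0) :
    ∃ p : ℕ → Cfg ι N → ℝ, (∀ n, p n ∈ polySpace ι N n) ∧
      Tendsto (fun n => ∫ g : PSU ι N, (p n (emb g) - w g) ^ 2 ∂(haarPi ι N)) atTop (𝓝 0) ∧
      (∀ n, ∫ g : PSU ι N, p n (emb g) ^ 2 ∂(haarPi ι N) ≤ ‖w‖ ^ 2) ∧
      ∀ n, ∫ g : PSU ι N, Gam (p n) (p n) (emb g) ∂(haarPi ι N) =
        -∫ g : PSU ι N, w g * (schW S (emb g) * p n (emb g)) ∂(haarPi ι N) := by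
  have hSc : ContDiff ℝ ∞ S := contDiff_of_mem_polySpace hS
  set wn : ℕ → Lp ℝ 2 (haarPi ι N) := fun n => (VPoly ι N n).starProjection w with hwn
  have hwn_mem : ∀ n, wn n ∈ VPoly ι N n := fun n => by
    rw [hwn]
    simp only [Submodule.starProjection_apply]
    exact Submodule.coe_mem _
  have hq : ∀ n, ∃ q : polySpace ι N n, TPoly n q = wn n := fun n => LinearMap.mem_range.1 (hwn_mem n)
  choose q hq using hq
  refine ⟨fun n => (q n).1, fun n => (q n).2, ?_, ?_, ?_⟩
  · have ht : Tendsto (fun n => wn n) atTop (𝓝 w) :=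
      Submodule.starProjection_tendsto_self (VPoly ι N) monotone_VPoly w top_le_closure_iSup_VPoly
    have ht' : Tendsto (fun n => ‖wn n - w‖ ^ 2) atTop (𝓝 0) := by
      have h1 : Tendsto (fun n => ‖wn n - w‖) atTop (𝓝 0) := tendsto_iff_norm_sub_tendsto_zero.1 ht
      simpa using h1.pow 2
    refine ht'.congr fun n => ?_
    rw [← hq n, TPoly_apply, norm_toL2_sub_sq]
    rfl
  · intro n
    have h1 : ‖wn n‖ ≤ ‖w‖ := Submodule.norm_starProjection_apply_le (VPoly ι N n) w
    have h2 : ∫ g : PSU ι N, (q n).1 (emb g) ^ 2 ∂(haarPi ι N) = ‖wn n‖ ^ 2 := by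
      rw [← hq n, TPoly_apply, norm_toL2_sq]; rfl
    rw [h2]
    exact pow_le_pow_left₀ (norm_nonneg _) h1 2
  · intro n
    set pn : Cfg ι N → ℝ := (q n).1 with hpn
    have hpn_mem : pn ∈ polySpace ι N n := (q n).2
    have hpc : ContDiff ℝ ∞ pn := contDiff_of_mem_polySpace hpn_mem
    set Lq : Lp ℝ 2 (haarPi ι N) := TPoly n ⟨Lap pn, Lap_mem_polySpace hpn_mem⟩ with hLq
    have hLq_mem : Lq ∈ VPoly ι N n := ⟨_, rfl⟩
    have h1 : ⟪w - wn n, Lq⟫_ℝ = 0 := Submodule.starProjection_inner_eq_zero w Lq hLq_mem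
    have h2 : ⟪wn n, Lq⟫_ℝ = -∫ g : PSU ι N, Gam pn pn (emb g) ∂(haarPi ι N) := by
      rw [← hq n, TPoly_apply, hLq, TPoly_apply, inner_toL2_toL2]
      exact integral_mul_Lap hN hpc hpc
    have h3 : ⟪w, Lq⟫_ℝ = ∫ g : PSU ι N, w g * Lap pn (emb g) ∂(haarPi ι N) := by
      rw [real_inner_comm, hLq, TPoly_apply, inner_toL2_left]
      refine integral_congr_ae (ae_of_all _ fun g => ?_)
      simp only [resPoly_apply]
      ring
    have h4 : ⟪w, Lq⟫_ℝ = ⟪wn n, Lq⟫_ℝ := by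
      have : w = (w - wn n) + wn n := by abel
      rw [this, inner_add_left, h1, zero_add]
    have h5 := hw n pn hpn_mem
    have hWc : Continuous fun g : PSU ι N => schW S (emb g) * pn (emb g) :=
      (continuous_restrict (contDiff_schW hSc)).mul (continuous_restrict hpc)
    have i1 : Integrable (fun g : PSU ι N => w g * Lap pn (emb g)) (haarPi ι N) := by
      have := integrable_continuous_mul_L2 (continuous_restrict (contDiff_Lap hpc)) w
      exact this.congr (ae_of_all _ fun g => mul_comm _ _)
    have i2 : Integrable (fun g : PSU ι N => w g * (schW S (emb g) * pn (emb g))) (haarPi ι N) := by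
      have := integrable_continuous_mul_L2 hWc w
      exact this.congr (ae_of_all _ fun g => mul_comm _ _)
    have h6 : ∫ g : PSU ι N, w g * Lap pn (emb g) ∂(haarPi ι N) =
        ∫ g : PSU ι N, w g * (schW S (emb g) * pn (emb g)) ∂(haarPi ι N) := by
      have : ∫ g : PSU ι N, w g * (Lap pn (emb g) - schW S (emb g) * pn (emb g)) ∂(haarPi ι N) =
          ∫ g : PSU ι N, w g * Lap pn (emb g) ∂(haarPi ι N) -
            ∫ g : PSU ι N, w g * (schW S (emb g) * pn (emb g)) ∂(haarPi ι N) := by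
        rw [← integral_sub i1 i2]
        exact integral_congr_ae (ae_of_all _ fun g => by ring)
      rw [this] at h5
      linarith
    linarith [h2, h3, h4, h6]

/-! ### Constants in `L²(σ^{⊗E})` -/

variable (ι N) in
/-- The constant function `r` as an element of `L²(σ^{⊗E})`. -/
def cL (r : ℝ) : Lp ℝ 2 (haarPi ι N) := toL2 ι N (ContinuousMap.const (PSU ι N) r)

omit [DecidableEq ι] in
/-- `cL r = r • cL 1`. -/
theorem cL_eq_smul (r : ℝ) : cL ι N r = r • cL ι N 1 := by
  rw [cL, cL, ← map_smul]
  congr 1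
  ext g; simp

omit [DecidableEq ι] in
/-- **Limits of constants are constants**: if `cL r_n → x` in `L²` then `x` is a.e. constant. -/
theorem ae_eq_const_of_tendsto_cL (x : Lp ℝ 2 (haarPi ι N)) (rs : ℕ → ℝ)
    (h : Tendsto (fun n => cL ι N (rs n)) atTop (𝓝 x)) : ∃ m : ℝ, (fun g => x g) =ᵐ[haarPi ι N] fun _ => m := by
  set C1 : Submodule ℝ (Lp ℝ 2 (haarPi ι N)) := Submodule.span ℝ {cL ι N 1} with hC1
  have hmem : ∀ r, cL ι N r ∈ C1 := fun r => by
    rw [cL_eq_smul]; exact Submodule.smul_mem _ r (Submodule.mem_span_singleton_self _)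
  have hclosed : IsClosed (C1 : Set (Lp ℝ 2 (haarPi ι N))) := Submodule.closed_of_finiteDimensional C1
  have hxC : x ∈ C1 := hclosed.mem_of_tendsto h (Eventually.of_forall fun n => hmem _)
  rw [hC1, Submodule.mem_span_singleton] at hxC
  obtain ⟨m, hm⟩ := hxC
  refine ⟨m, ?_⟩
  rw [← hm, ← cL_eq_smul, cL]
  filter_upwards [ContinuousMap.coeFn_toLp (p := 2) (μ := haarPi ι N) (𝕜 := ℝ) (ContinuousMap.const (PSU ι N) m)]
    with g hg
  rw [hg]
  rfl

omit [DecidableEq ι] in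
/-- `‖toL2 φ - cL r‖² = ∫ (φ - r)²`. -/
theorem norm_toL2_sub_cL_sq (φ : C(PSU ι N, ℝ)) (r : ℝ) :
    ‖toL2 ι N φ - cL ι N r‖ ^ 2 = ∫ g, (φ g - r) ^ 2 ∂(haarPi ι N) := by
  rw [cL, norm_toL2_sub_toL2_sq]; rfl

/-- **THM(IV)₀**: an element of `L²(σ^{⊗E})` orthogonal to `Δ𝒫` is a.e. constant (the projections have
`∫ Γ = 0`, hence are constant on the connected group `SU(N)^E`, and constants form a closed line). -/
theorem ae_eq_const_of_orthogonal_Lap (hN : N ≠ 0) (w : Lp ℝ 2 (haarPi ι N))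
    (hw : ∀ n, ∀ p ∈ polySpace ι N n, ∫ g : PSU ι N, w g * Lap p (emb g) ∂(haarPi ι N) = 0) :
    ∃ m : ℝ, (fun g => w g) =ᵐ[haarPi ι N] fun _ => m := by
  have hw' : ∀ n, ∀ p ∈ polySpace ι N n,
      ∫ g : PSU ι N, w g * (Lap p (emb g) - schW (fun _ : Cfg ι N => (0 : ℝ)) (emb g) * p (emb g)) ∂(haarPi ι N) = 0 := by
    intro n p hp
    simpa [schW_zero] using hw n p hp
  obtain ⟨p, hp, hconv, -, hid⟩ := exists_proj_seq hN (dS := 0) (const_mem_polySpace 0 (0 : ℝ)) w hw'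
  have hconst : ∀ n (g : PSU ι N), p n (emb g) = p n (1 : Cfg ι N) := by
    intro n
    have hpc : ContDiff ℝ ∞ (p n) := contDiff_of_mem_polySpace (hp n)
    have hint : ∫ g : PSU ι N, Gam (p n) (p n) (emb g) ∂(haarPi ι N) = 0 := by
      rw [hid n]; simp [schW_zero]
    have hcont : Continuous fun g : PSU ι N => Gam (p n) (p n) (emb g) := continuous_restrict (contDiff_Gam hpc hpc)
    have hae : (fun g : PSU ι N => Gam (p n) (p n) (emb g)) =ᵐ[haarPi ι N] 0 :=
      (integral_eq_zero_iff_of_nonneg (fun g => Gam_self_nonneg _ _)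
        (integrable_of_continuous_PSU hcont (haarPi ι N))).1 hint
    have hzero : (fun g : PSU ι N => Gam (p n) (p n) (emb g)) = 0 :=
      (hcont.ae_eq_iff_eq (haarPi ι N) continuous_const).1 hae
    exact eq_of_Gam_eq_zero hN hpc (fun g => congrFun hzero g)
  have hlim : Tendsto (fun n => cL ι N (p n 1)) atTop (𝓝 w) := by
    rw [tendsto_iff_norm_sub_tendsto_zero]
    have h0 : Tendsto (fun n => ‖cL ι N (p n 1) - w‖ ^ 2) atTop (𝓝 0) := by
      refine hconv.congr fun n => ?_
      rw [cL, norm_toL2_sub_sq]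
      refine integral_congr_ae (ae_of_all _ fun g => ?_)
      simp [hconst n g]
    have h1 : Tendsto (fun n => Real.sqrt (‖cL ι N (p n 1) - w‖ ^ 2)) atTop (𝓝 (Real.sqrt 0)) :=
      (Real.continuous_sqrt.tendsto 0).comp h0
    rw [Real.sqrt_zero] at h1
    exact h1.congr fun n => Real.sqrt_sq (norm_nonneg _)
  exact ae_eq_const_of_tendsto_cL w (fun n => p n 1) hlim

/-! ### From THM(IV) to the Poincaré inequality: approximate solutions of the Poisson equation -/

/-- `p ↦ (Δ - W)p|_{SU(N)^E}` as a linear map `𝒫_n → C(SU(N)^E, ℝ)`. -/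
def gsCM {S : Cfg ι N → ℝ} (hS : ContDiff ℝ ∞ S) (n : ℕ) : polySpace ι N n →ₗ[ℝ] C(PSU ι N, ℝ) where
  toFun p := resCM (fun Q => Lap p.1 Q - schW S Q * p.1 Q)
    (continuous_restrict ((contDiff_Lap (contDiff_of_mem_polySpace p.2)).sub
      ((contDiff_schW hS).mul (contDiff_of_mem_polySpace p.2))))
  map_add' p q := by
    ext g
    simp only [resCM, ContinuousMap.coe_mk, ContinuousMap.add_apply, Submodule.coe_add]
    rw [Lap_add (contDiff_of_mem_polySpace p.2) (contDiff_of_mem_polySpace q.2)]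
    simp only [Pi.add_apply]
    ring
  map_smul' r p := by
    ext g
    simp only [resCM, ContinuousMap.coe_mk, ContinuousMap.smul_apply, Submodule.coe_smul, RingHom.id_apply,
      smul_eq_mul]
    rw [Lap_smul r (contDiff_of_mem_polySpace p.2)]
    simp only [Pi.smul_apply, smul_eq_mul]
    ring

/-- Evaluation of `gsCM`. -/
@[simp] theorem gsCM_apply {S : Cfg ι N → ℝ} (hS : ContDiff ℝ ∞ S) {n : ℕ} (p : polySpace ι N n) (g : PSU ι N) :
    gsCM hS n p g = Lap p.1 (emb g) - schW S (emb g) * p.1 (emb g) := rfl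

/-- `p ↦ (Δ - W)p` into `L²(σ^{⊗E})`. -/
def AnPoly {S : Cfg ι N → ℝ} (hS : ContDiff ℝ ∞ S) (n : ℕ) : polySpace ι N n →ₗ[ℝ] Lp ℝ 2 (haarPi ι N) :=
  (toL2 ι N).toLinearMap.comp (gsCM hS n)

/-- `AnPoly hS n p = toL2 (gsCM hS n p)`. -/
theorem AnPoly_apply {S : Cfg ι N → ℝ} (hS : ContDiff ℝ ∞ S) {n : ℕ} (p : polySpace ι N n) :
    AnPoly hS n p = toL2 ι N (gsCM hS n p) := rfl

/-- The ranges of `AnPoly` are monotone in the degree. -/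
theorem monotone_range_AnPoly {S : Cfg ι N → ℝ} (hS : ContDiff ℝ ∞ S) :
    Monotone fun n => LinearMap.range (AnPoly (ι := ι) (N := N) hS n) := by
  intro n n' h x hx
  obtain ⟨p, rfl⟩ := hx
  exact ⟨⟨p.1, polySpace_mono h p.2⟩, rfl⟩

/-- **Poincaré inequality from THM(IV)** (duality + double orthogonal complement: the class
`{e^{-S/2} p : p polynomial}` solves the Poisson equation `L_S v = u - m` approximately in
`L²(e^S σ^{⊗E})`). For a polynomial potential `S ∈ 𝒫_d` with `HessBound S Λ`, `K = N/2 - Λ > 0`, and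
smooth `u` with `e^S σ^{⊗E}`-mean `m`: `K ∫ e^S (u - m)² dσ^{⊗E} ≤ ∫ e^S Γ(u,u) dσ^{⊗E}`. -/
theorem poincare_of_thm4 (hN : N ≠ 0) {dS : ℕ} {S : Cfg ι N → ℝ} (hSp : S ∈ polySpace ι N dS) {Λ : ℝ}
    (hHess : HessBound S Λ) (hK : 0 < (N : ℝ) / 2 - Λ)
    (hthm : ∀ w : Lp ℝ 2 (haarPi ι N), (∀ n, ∀ p ∈ polySpace ι N n,
      ∫ g : PSU ι N, w g * (Lap p (emb g) - schW S (emb g) * p (emb g)) ∂(haarPi ι N) = 0) →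
      ∃ m : ℝ, (fun g => w g) =ᵐ[haarPi ι N] fun g => m * Real.exp (S (emb g) / 2))
    {u : Cfg ι N → ℝ} (hu : ContDiff ℝ ∞ u) :
    ((N : ℝ) / 2 - Λ) *
        ∫ g : PSU ι N, Real.exp (S (emb g)) * (u (emb g) -
          (∫ g : PSU ι N, Real.exp (S (emb g)) * u (emb g) ∂(haarPi ι N)) /
            (∫ g : PSU ι N, Real.exp (S (emb g)) ∂(haarPi ι N))) ^ 2 ∂(haarPi ι N) ≤
      ∫ g : PSU ι N, Real.exp (S (emb g)) * Gam u u (emb g) ∂(haarPi ι N) := by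
  have hS : ContDiff ℝ ∞ S := contDiff_of_mem_polySpace hSp
  have hSc : Continuous fun g : PSU ι N => S (emb g) := continuous_restrict hS
  have hwc : Continuous fun g : PSU ι N => Real.exp (S (emb g)) := Real.continuous_exp.comp hSc
  set Z : ℝ := ∫ g : PSU ι N, Real.exp (S (emb g)) ∂(haarPi ι N) with hZ
  have hZpos : 0 < Z := integral_exp_pos (integrable_of_continuous_PSU hwc _)
  set m : ℝ := (∫ g : PSU ι N, Real.exp (S (emb g)) * u (emb g) ∂(haarPi ι N)) / Z with hmdef
  have huc : Continuous fun g : PSU ι N => u (emb g) := continuous_restrict hu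
  have hm0 : ∫ g : PSU ι N, Real.exp (S (emb g)) * (u (emb g) - m) ∂(haarPi ι N) = 0 := by
    have i1 : Integrable (fun g : PSU ι N => Real.exp (S (emb g)) * u (emb g)) (haarPi ι N) :=
      integrable_of_continuous_PSU (hwc.mul huc) _
    have i2 : Integrable (fun g : PSU ι N => Real.exp (S (emb g)) * m) (haarPi ι N) :=
      integrable_of_continuous_PSU (hwc.mul continuous_const) _
    have : ∫ g : PSU ι N, Real.exp (S (emb g)) * (u (emb g) - m) ∂(haarPi ι N) =
        ∫ g : PSU ι N, Real.exp (S (emb g)) * u (emb g) ∂(haarPi ι N) -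
          ∫ g : PSU ι N, Real.exp (S (emb g)) * m ∂(haarPi ι N) := by
      rw [← integral_sub i1 i2]; exact integral_congr_ae (ae_of_all _ fun g => by ring)
    rw [this, integral_mul_const, hmdef, ← hZ]
    field_simp
    ring
  have hyc : Continuous fun g : PSU ι N => Real.exp (S (emb g) / 2) * (u (emb g) - m) :=
    (Real.continuous_exp.comp (hSc.div_const 2)).mul (huc.sub continuous_const)
  set y : Lp ℝ 2 (haarPi ι N) := toL2 ι N (resCM (fun Q => Real.exp (S Q / 2) * (u Q - m)) hyc) with hydef
  set R : Submodule ℝ (Lp ℝ 2 (haarPi ι N)) := ⨆ n, LinearMap.range (AnPoly (ι := ι) (N := N) hS n) with hRdef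
  have hyRR : y ∈ Rᗮᗮ := by
    rw [Submodule.mem_orthogonal]
    intro z hz
    have hz' : ∀ n, ∀ p ∈ polySpace ι N n,
        ∫ g : PSU ι N, z g * (Lap p (emb g) - schW S (emb g) * p (emb g)) ∂(haarPi ι N) = 0 := by
      intro n p hp
      have hmem : AnPoly hS n ⟨p, hp⟩ ∈ R := (le_iSup (fun n => LinearMap.range (AnPoly (ι := ι) (N := N) hS n)) n) ⟨_, rfl⟩
      have h0 : ⟪AnPoly hS n ⟨p, hp⟩, z⟫_ℝ = 0 := (Submodule.mem_orthogonal R z).1 hz _ hmem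
      rw [AnPoly_apply, inner_toL2_left] at h0
      rw [← h0]
      refine integral_congr_ae (ae_of_all _ fun g => ?_)
      simp only [gsCM_apply]
      ring
    obtain ⟨mz, hmz⟩ := hthm z hz'
    rw [real_inner_comm, hydef, inner_toL2_left]
    have : ∫ g : PSU ι N, (resCM (fun Q => Real.exp (S Q / 2) * (u Q - m)) hyc) g * z g ∂(haarPi ι N) =
        ∫ g : PSU ι N, mz * (Real.exp (S (emb g)) * (u (emb g) - m)) ∂(haarPi ι N) := by
      refine integral_congr_ae ?_
      filter_upwards [hmz] with g hg
      rw [hg]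
      simp only [resCM, ContinuousMap.coe_mk]
      rw [← SUNBakryEmery.exp_half_mul_exp_half (S (emb g))]
      ring
    rw [this, integral_const_mul, hm0, mul_zero]
  have hyclos : y ∈ R.topologicalClosure := by
    rw [← Submodule.orthogonal_orthogonal_eq_closure]; exact hyRR
  have hyclos' : y ∈ closure (R : Set (Lp ℝ 2 (haarPi ι N))) := by
    rw [← Submodule.topologicalClosure_coe]; exact hyclos
  obtain ⟨r, hrR, hrlim⟩ := mem_closure_iff_seq_limit.1 hyclos'
  have hdir : Directed (· ≤ ·) fun n => LinearMap.range (AnPoly (ι := ι) (N := N) hS n) :=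
    (monotone_range_AnPoly hS).directed_le
  have hex : ∀ k, ∃ (n : ℕ) (p : polySpace ι N n), AnPoly hS n p = r k := fun k => by
    obtain ⟨n, hn⟩ := (Submodule.mem_iSup_of_directed _ hdir).1 (hrR k)
    obtain ⟨p, hp⟩ := LinearMap.mem_range.1 hn
    exact ⟨n, p, hp⟩
  choose nk pk hpk using hex
  set v : ℕ → Cfg ι N → ℝ := fun k Q => Real.exp (-S Q / 2) * (pk k).1 Q with hvdef
  have hv : ∀ k, ContDiff ℝ ∞ (v k) := fun k => contDiff_groundState hS (contDiff_of_mem_polySpace (pk k).2)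
  have hconv : Tendsto (fun k => ∫ g : PSU ι N, Real.exp (S (emb g)) *
      (genL S (v k) (emb g) - (u (emb g) - m)) ^ 2 ∂(haarPi ι N)) atTop (𝓝 0) := by
    have h1 : Tendsto (fun k => ‖r k - y‖ ^ 2) atTop (𝓝 0) := by
      have := tendsto_iff_norm_sub_tendsto_zero.1 hrlim
      simpa using this.pow 2
    refine h1.congr fun k => ?_
    rw [← hpk k, AnPoly_apply, hydef, norm_toL2_sub_toL2_sq]
    refine integral_congr_ae (ae_of_all _ fun g => ?_)
    simp only [gsCM_apply, resCM, ContinuousMap.coe_mk, hvdef]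
    rw [genL_groundState hS (contDiff_of_mem_polySpace (pk k).2)]
    have e1 := SUNBakryEmery.exp_half_mul_exp_half (S (emb g))
    have e2 := SUNBakryEmery.exp_half_mul_exp_neg_half (S (emb g))
    have hW : schW S (emb g) = (1 / 4) * Gam S S (emb g) + (1 / 2) * Lap S (emb g) := rfl
    rw [hW]
    linear_combination ((Real.exp (-S (emb g) / 2) * (Lap (pk k).1 (emb g) -
      ((1 / 4) * Gam S S (emb g) + (1 / 2) * Lap S (emb g)) * (pk k).1 (emb g)) - (u (emb g) - m)) ^ 2) * e1 +
      (-((Lap (pk k).1 (emb g) - ((1 / 4) * Gam S S (emb g) + (1 / 2) * Lap S (emb g)) * (pk k).1 (emb g)) *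
        ((Lap (pk k).1 (emb g) - ((1 / 4) * Gam S S (emb g) + (1 / 2) * Lap S (emb g)) * (pk k).1 (emb g)) *
          (1 + Real.exp (S (emb g) / 2) * Real.exp (-S (emb g) / 2)) -
            2 * Real.exp (S (emb g) / 2) * (u (emb g) - m)))) * e2
  exact poincare_of_approx hN hS hHess hK hu m v hv hconv

/-- **Poincaré inequality for the product Haar measure on `SU(N)^E`** with the Bakry–Émery constant
`2/N` (`Ric = N/2`): `(N/2) Var_{σ^{⊗E}}(u) ≤ ∫ Γ(u,u) dσ^{⊗E}` for smooth `u`. -/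
theorem poincare_haar (hN : N ≠ 0) {u : Cfg ι N → ℝ} (hu : ContDiff ℝ ∞ u) :
    (N : ℝ) / 2 * ∫ g : PSU ι N, (u (emb g) - ∫ g : PSU ι N, u (emb g) ∂(haarPi ι N)) ^ 2 ∂(haarPi ι N) ≤
      ∫ g : PSU ι N, Gam u u (emb g) ∂(haarPi ι N) := by
  have hK : 0 < (N : ℝ) / 2 - 0 := by
    rw [sub_zero]; exact div_pos (Nat.cast_pos.2 (Nat.pos_of_ne_zero hN)) two_pos
  have hHess : HessBound (fun _ : Cfg ι N => (0 : ℝ)) 0 := by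
    intro g V _ _
    have h1 : algD V (fun _ : Cfg ι N => (0 : ℝ)) = 0 := algD_const 0 V
    rw [h1, show algD V (0 : Cfg ι N → ℝ) = 0 from algD_const 0 V]
    simp only [Pi.zero_apply, abs_zero, zero_mul, le_refl]
  have hthm : ∀ w : Lp ℝ 2 (haarPi ι N), (∀ n, ∀ p ∈ polySpace ι N n,
      ∫ g : PSU ι N, w g * (Lap p (emb g) - schW (fun _ : Cfg ι N => (0 : ℝ)) (emb g) * p (emb g)) ∂(haarPi ι N) = 0) →
      ∃ m : ℝ, (fun g => w g) =ᵐ[haarPi ι N] fun g => m * Real.exp ((fun _ : Cfg ι N => (0 : ℝ)) (emb g) / 2) := by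
    intro w hw
    have hw' : ∀ n, ∀ p ∈ polySpace ι N n, ∫ g : PSU ι N, w g * Lap p (emb g) ∂(haarPi ι N) = 0 := by
      intro n p hp; simpa [schW_zero] using hw n p hp
    obtain ⟨m, hm⟩ := ae_eq_const_of_orthogonal_Lap hN w hw'
    exact ⟨m, hm.trans (ae_of_all _ fun g => by simp)⟩
  have h := poincare_of_thm4 hN (dS := 0) (const_mem_polySpace 0 (0 : ℝ)) hHess hK hthm hu
  simp only [Real.exp_zero, one_mul, sub_zero, integral_const, smul_eq_mul,
    probReal_univ, div_one] at h
  exact h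

end LatticeBakryEmery

end Summit.Ventures.YMGap
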